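import Summits.AtomisticToContinuum.Crystallization.Theorems.OverbindingBudgetAffinePatternRigidCore

/-!
# ★★ `PatternRigid (2/5) (1/100)` and the Z2 record without the rigidity hypothesis
# (decomp-a2c lens-4, generation 66, Deliverable D2; critic row 1101 (iii) item (iv))

Imports D1 `…PatternRigidCore` (`rigid_core`).  PROVED here (0 sorry, standard axioms; the finite checks are `decide` over 18-element
lists / finsets of `Fin 3 → ℤ`, the identities are `ring` / `linear_combination`):
* §R4 Barlow side: `twoShellIdx op om` as the explicit list `idxList op om` (4 label cases, `decide`), `card = 18`, the coordinate form
  `inner_idxPos`, and ★ ISOTROPY `sum_inner_idxPos_sq : Σ_{t ∈ twoShellIdx (s 0) (−s(−1))} ⟪idxPos s t, y⟫² = 8‖y‖²` for every Hägg `s`.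
* §R5 pattern side: the integer models `fccList` / `hcpList` (= `fccInt ∪ fccSecondShellInt`, `hcpInt ∪ hcpSecondShellInt`, `decide`), bases
  `fccBInt = (1,1,0),(1,0,1),(0,1,1)` (`q = 1`, `C = 3`) and `hcpBInt = (3,−3,0),(3,0,3),(−4,−1,−1)` (`q = 2`, `C = 9`) with their
  coordinate tables `fccTab_spec` / `hcpTab_spec` (`decide`), second moments `16·id` / `144·id` of the integer models (`ring`), hence
  ★ `sum_inner_sq_fcc` / `sum_inner_sq_hcp : Σ_{v∈P} ⟪v,x⟫² = 8‖x‖²`, linear independence and membership of the scaled bases.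
* §R6 ★★ `patternRigid_two_fifths : PatternRigid (2/5) (1/100)` (thresholds `(5/3)(1+3)/100 = 1/15 < 1/4`, `(5/3)(2+9)/100 = 11/60 < 1/4`),
  `PatternRigid.of_le` (antitone in `τ`), `patternRigid_of_le : τ ≤ 1/100 → PatternRigid (2/5) τ`, and
  ★★★ `farCoreExcess_record_of_farWindowData'` = g65's record with the hypothesis `PatternRigid (2/5) τ` DISCHARGED (`0 < τ ≤ 1/100`):
  `Z2 ⟸ HcpEnergyUpper u [ANALYTIC/CERT] ∧ (u ≤ −(1/(2·10⁷) + 10⁻⁹)) ∧ far-window TABLE at tolerance 1/2000 − τ [CERT]`.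
Margins: the granularity constant is `1/(2√3) ≈ 0.2887 > 1/4`; the largest admissible `τ₀` of this proof is `3/(20·11·… ) ≈ 1/74` (hcp), far
above the record's `τ < 1/2000`.
-/

namespace Summit.AtomisticToContinuum.Crystallization.Theorems.OverbindingBudgetAffineFarSmoothSplit

open scoped BigOperators Classical InnerProductSpace
open Literature.MathematicalPhysics.StatisticalMechanics Literature.Geometry.DiscreteGeometry

local notation "E3" => EuclideanSpace ℝ (Fin 3)

-- PRIVATE copies (landing lane): these helpers are `private` in `OverbindingBudgetAffinePatternRigidCore` (dedup gate), so each consumer module carries its own private copy.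
/-- `normSq_coords` (docstring added by the landing lane; see the module docstring). [formal bookkeeping] -/
private theorem normSq_coords (v : E3) : ‖v‖ ^ 2 = v 0 ^ 2 + v 1 ^ 2 + v 2 ^ 2 := by
  rw [EuclideanSpace.norm_eq, Real.sq_sqrt (Finset.sum_nonneg fun i _ => by positivity), Fin.sum_univ_three]
  simp only [Real.norm_eq_abs, sq_abs]

/-- `inner_coords` (docstring added by the landing lane; see the module docstring). [formal bookkeeping] -/
private theorem inner_coords (v w : E3) : ⟪v, w⟫_ℝ = v 0 * w 0 + v 1 * w 1 + v 2 * w 2 := by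
  rw [PiLp.inner_apply, Fin.sum_univ_three]
  simp only [RCLike.inner_apply, conj_trivial]
  ring

/-- `label_one` (docstring added by the landing lane; see the module docstring). [formal bookkeeping] -/
private theorem label_one (s : ℤ → ℤ) : haggLabel s 1 = s 0 := by simpa using haggLabel_succ s 0

/-- `label_neg_one` (docstring added by the landing lane; see the module docstring). [formal bookkeeping] -/
private theorem label_neg_one (s : ℤ → ℤ) : haggLabel s (-1) = -s (-1) := by
  have h := haggLabel_succ s (-1)
  simp at h
  linarith

namespace PatternRigidProof

/-! ## §R4 The Barlow side: the 18 two-shell points are an `8`-isotropic integer configuration -/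

/-- The 18 two-shell index triples as a list (labels `op = ℓ(1)`, `om = ℓ(−1)`). -/
def idxList (op om : ℤ) : List (ℤ × ℤ × ℤ) :=
  [(0, 1, 0), (0, 0, 1), (0, -1, 0), (0, 0, -1), (0, 1, -1), (0, -1, 1),
   (1, 0, 0), (1, -op, 0), (1, 0, -op), (-1, 0, 0), (-1, -om, 0), (-1, 0, -om),
   (1, 1, -1), (1, -1, 1), (1, -op, -op), (-1, 1, -1), (-1, -1, 1), (-1, -om, -om)]

/-- `twoShellIdx_eq_toFinset` (docstring added by the landing lane; see the module docstring). [formal bookkeeping] -/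
theorem twoShellIdx_eq_toFinset {op om : ℤ} (hop : op = 1 ∨ op = -1) (hom : om = 1 ∨ om = -1) :
    twoShellIdx op om = (idxList op om).toFinset := by
  rcases hop with rfl | rfl <;> rcases hom with rfl | rfl <;> decide

/-- `idxList_nodup` (docstring added by the landing lane; see the module docstring). [formal bookkeeping] -/
theorem idxList_nodup {op om : ℤ} (hop : op = 1 ∨ op = -1) (hom : om = 1 ∨ om = -1) : (idxList op om).Nodup := by
  rcases hop with rfl | rfl <;> rcases hom with rfl | rfl <;> decide

/-- `card_twoShellIdx` (docstring added by the landing lane; see the module docstring). [formal bookkeeping] -/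
theorem card_twoShellIdx {op om : ℤ} (hop : op = 1 ∨ op = -1) (hom : om = 1 ∨ om = -1) : (twoShellIdx op om).card = 18 := by
  rcases hop with rfl | rfl <;> rcases hom with rfl | rfl <;> decide

/-- The inner product of a structure point with `y`, in coordinates. [this file] -/
theorem inner_idxPos (s : ℤ → ℤ) (t : ℤ × ℤ × ℤ) (y : E3) :
    ⟪idxPos s t, y⟫_ℝ = (t.2.1 : ℝ) * y 0 + (t.2.2 : ℝ) * (y 0 / 2 + Real.sqrt 3 / 2 * y 1) +
      (haggLabel s t.1 : ℝ) * (y 0 / 2 + Real.sqrt 3 / 6 * y 1) + (t.1 : ℝ) * (Real.sqrt (2 / 3) * y 2) := by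
  rw [idxPos, barlowPos, inner_coords]
  simp [triangularVec₁, triangularVec₂, barlowOffset, layerNormal]
  ring

/-- ★ ISOTROPY of the two Barlow shells: `Σ_{t} ⟪p_t, y⟫² = 8‖y‖²` for every Hägg sequence. [this file] -/
theorem sum_inner_idxPos_sq {s : ℤ → ℤ} (hs : IsHaggSeq s) (y : E3) :
    ∑ t ∈ twoShellIdx (s 0) (-s (-1)), ⟪idxPos s t, y⟫_ℝ ^ 2 = 8 * ‖y‖ ^ 2 := by
  obtain ⟨hop, hom⟩ := labels_sign hs
  have hl1 : (haggLabel s 1 : ℝ) = ((s 0 : ℤ) : ℝ) := by rw [label_one]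
  have hl2 : (haggLabel s (-1) : ℝ) = ((-s (-1) : ℤ) : ℝ) := by rw [label_neg_one]
  have h3 : Real.sqrt 3 ^ 2 = 3 := Real.sq_sqrt (by norm_num)
  have h23 : Real.sqrt (2 / 3) ^ 2 = 2 / 3 := Real.sq_sqrt (by norm_num)
  rw [twoShellIdx_eq_toFinset hop hom, List.sum_toFinset _ (idxList_nodup hop hom), normSq_coords]
  rcases hop with h0 | h0 <;> rcases hom with h1 | h1 <;>
  · rw [h0] at hl1 ⊢
    rw [h1] at hl2 ⊢
    simp only [idxList, List.map_cons, List.map_nil, List.sum_cons, List.sum_nil, inner_idxPos, hl1, hl2, haggLabel_zero]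
    push_cast
    linear_combination (8 / 3 * y 1 ^ 2) * h3 + (12 * y 2 ^ 2) * h23

/-! ## §R5 The pattern side: integer coordinate tables and isotropy of the two model patterns -/

/-- `intVec` is `ℤ`-linear (coordinatewise). [this file] -/
theorem scaled_eq_sum_of_int {N q : ℕ} {z : Fin 3 → ℤ} {b : Fin 3 → (Fin 3 → ℤ)} {c : Fin 3 → ℤ}
    (h : (q : ℤ) • z = c 0 • b 0 + c 1 • b 1 + c 2 • b 2) :
    (q : ℝ) • ((Real.sqrt N)⁻¹ • intVec z) = ∑ i, (c i : ℝ) • ((Real.sqrt N)⁻¹ • intVec (b i)) := by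
  rw [Fin.sum_univ_three]
  ext j
  have hj := congrArg (fun w : Fin 3 → ℤ => ((w j : ℤ) : ℝ)) h
  simp only [Pi.add_apply, Pi.smul_apply] at hj
  simp only [smul_eq_mul, Int.cast_add, Int.cast_mul, Int.cast_natCast] at hj
  simp only [PiLp.add_apply, PiLp.smul_apply, smul_eq_mul, intVec_apply]
  linear_combination (Real.sqrt N)⁻¹ * hj

/-- `⟪z/√N, x⟫ = (z·x)/√N`. [this file] -/
theorem inner_scaled_intVec (N : ℕ) (z : Fin 3 → ℤ) (x : E3) :
    ⟪(Real.sqrt N)⁻¹ • intVec z, x⟫_ℝ = (Real.sqrt N)⁻¹ * ((z 0 : ℝ) * x 0 + (z 1 : ℝ) * x 1 + (z 2 : ℝ) * x 2) := by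
  rw [real_inner_smul_left, inner_coords]
  simp [intVec_apply]

/-- Second moments of a scaled pattern, reduced to a list sum in the integer model. [this file] -/
theorem sum_inner_sq_scaledPattern {S : Finset (Fin 3 → ℤ)} {L : List (Fin 3 → ℤ)} (hL : S = L.toFinset) (hnd : L.Nodup)
    {N : ℕ} (hN : N ≠ 0) (x : E3) :
    ∑ v ∈ scaledPattern S N, ⟪v, x⟫_ℝ ^ 2 =
      (N : ℝ)⁻¹ * (L.map fun z : Fin 3 → ℤ => ((z 0 : ℝ) * x 0 + (z 1 : ℝ) * x 1 + (z 2 : ℝ) * x 2) ^ 2).sum := by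
  rw [scaledPattern, Finset.sum_image (scaledPattern_map_injective hN).injOn, hL, List.sum_toFinset _ hnd, ← List.sum_map_mul_left]
  refine congrArg List.sum (List.map_congr_left fun z _ => ?_)
  rw [inner_scaled_intVec, mul_pow, inv_pow, Real.sq_sqrt (Nat.cast_nonneg _)]

/-- The fcc two-shell integer model as a list, its basis `(1,1,0),(1,0,1),(0,1,1)` and the integer coordinate table (`q = 1`, `C = 3`). -/
def fccList : List (Fin 3 → ℤ) :=
  [![1, 1, 0], ![1, -1, 0], ![-1, 1, 0], ![-1, -1, 0], ![1, 0, 1], ![1, 0, -1], ![-1, 0, 1], ![-1, 0, -1],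
   ![0, 1, 1], ![0, 1, -1], ![0, -1, 1], ![0, -1, -1], ![2, 0, 0], ![-2, 0, 0], ![0, 2, 0], ![0, -2, 0], ![0, 0, 2], ![0, 0, -2]]

/-- `fccBInt` (docstring added by the landing lane; see the module docstring). [formal bookkeeping] -/
def fccBInt : Fin 3 → (Fin 3 → ℤ) := ![![1, 1, 0], ![1, 0, 1], ![0, 1, 1]]

/-- Coordinate table: `(z, c)` with `z = c₀ b₀ + c₁ b₁ + c₂ b₂`. -/
def fccTab : List ((Fin 3 → ℤ) × (Fin 3 → ℤ)) :=
  [(![1, 1, 0], ![1, 0, 0]), (![1, -1, 0], ![0, 1, -1]), (![-1, 1, 0], ![0, -1, 1]), (![-1, -1, 0], ![-1, 0, 0]),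
   (![1, 0, 1], ![0, 1, 0]), (![1, 0, -1], ![1, 0, -1]), (![-1, 0, 1], ![-1, 0, 1]), (![-1, 0, -1], ![0, -1, 0]),
   (![0, 1, 1], ![0, 0, 1]), (![0, 1, -1], ![1, -1, 0]), (![0, -1, 1], ![-1, 1, 0]), (![0, -1, -1], ![0, 0, -1]),
   (![2, 0, 0], ![1, 1, -1]), (![-2, 0, 0], ![-1, -1, 1]), (![0, 2, 0], ![1, -1, 1]), (![0, -2, 0], ![-1, 1, -1]),
   (![0, 0, 2], ![-1, 1, 1]), (![0, 0, -2], ![1, -1, -1])]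

/-- The hcp two-shell integer model as a list, its basis `(3,−3,0),(3,0,3),(−4,−1,−1)` and the table (`q = 2`, `C = 9`). -/
def hcpList : List (Fin 3 → ℤ) :=
  [![3, -3, 0], ![-3, 3, 0], ![3, 0, -3], ![-3, 0, 3], ![0, 3, -3], ![0, -3, 3], ![3, 3, 0], ![3, 0, 3], ![0, 3, 3],
   ![-1, -1, -4], ![-1, -4, -1], ![-4, -1, -1], ![6, 0, 0], ![0, 6, 0], ![0, 0, 6], ![2, -4, -4], ![-4, 2, -4], ![-4, -4, 2]]

/-- `hcpBInt` (docstring added by the landing lane; see the module docstring). [formal bookkeeping] -/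
def hcpBInt : Fin 3 → (Fin 3 → ℤ) := ![![3, -3, 0], ![3, 0, 3], ![-4, -1, -1]]

/-- Coordinate table: `(z, c)` with `2z = c₀ b₀ + c₁ b₁ + c₂ b₂`. -/
def hcpTab : List ((Fin 3 → ℤ) × (Fin 3 → ℤ)) :=
  [(![3, -3, 0], ![2, 0, 0]), (![-3, 3, 0], ![-2, 0, 0]), (![3, 0, -3], ![1, -3, -3]), (![-3, 0, 3], ![-1, 3, 3]),
   (![0, 3, -3], ![-1, -3, -3]), (![0, -3, 3], ![1, 3, 3]), (![3, 3, 0], ![-1, -1, -3]), (![3, 0, 3], ![0, 2, 0]),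
   (![0, 3, 3], ![-2, 2, 0]), (![-1, -1, -4], ![1, -3, -1]), (![-1, -4, -1], ![2, 0, 2]), (![-4, -1, -1], ![0, 0, 2]),
   (![6, 0, 0], ![1, -1, -3]), (![0, 6, 0], ![-3, -1, -3]), (![0, 0, 6], ![-1, 5, 3]), (![2, -4, -4], ![3, -3, -1]),
   (![-4, 2, -4], ![-1, -3, -1]), (![-4, -4, 2], ![1, 3, 5])]

/-- Table lookup of the integer coordinates. -/
def tabCoef (tab : List ((Fin 3 → ℤ) × (Fin 3 → ℤ))) (z : Fin 3 → ℤ) : Fin 3 → ℤ :=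
  ((tab.find? fun r => r.1 = z).map Prod.snd).getD 0

/-- `fccInt_union_eq` (docstring added by the landing lane; see the module docstring). [formal bookkeeping] -/
theorem fccInt_union_eq : fccInt ∪ fccSecondShellInt = fccList.toFinset := by decide
/-- `fccList_nodup` (docstring added by the landing lane; see the module docstring). [formal bookkeeping] -/
theorem fccList_nodup : fccList.Nodup := by decide
/-- `hcpInt_union_eq` (docstring added by the landing lane; see the module docstring). [formal bookkeeping] -/
theorem hcpInt_union_eq : hcpInt ∪ hcpSecondShellInt = hcpList.toFinset := by decide
/-- `hcpList_nodup` (docstring added by the landing lane; see the module docstring). [formal bookkeeping] -/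
theorem hcpList_nodup : hcpList.Nodup := by decide

/-- `fccBInt_mem` (docstring added by the landing lane; see the module docstring). [formal bookkeeping] -/
theorem fccBInt_mem : ∀ i, fccBInt i ∈ fccInt ∪ fccSecondShellInt := by decide
/-- `hcpBInt_mem` (docstring added by the landing lane; see the module docstring). [formal bookkeeping] -/
theorem hcpBInt_mem : ∀ i, hcpBInt i ∈ hcpInt ∪ hcpSecondShellInt := by decide

/-- ★ The fcc coordinate table is correct: `z = Σ cᵢ bᵢ`, `Σ|cᵢ| ≤ 3`. [this file, `decide`] -/
theorem fccTab_spec : ∀ z ∈ fccInt ∪ fccSecondShellInt,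
    (1 : ℤ) • z = tabCoef fccTab z 0 • fccBInt 0 + tabCoef fccTab z 1 • fccBInt 1 + tabCoef fccTab z 2 • fccBInt 2 ∧
      |tabCoef fccTab z 0| + |tabCoef fccTab z 1| + |tabCoef fccTab z 2| ≤ 3 := by
  decide

/-- ★ The hcp coordinate table is correct: `2z = Σ cᵢ bᵢ`, `Σ|cᵢ| ≤ 9`. [this file, `decide`] -/
theorem hcpTab_spec : ∀ z ∈ hcpInt ∪ hcpSecondShellInt,
    (2 : ℤ) • z = tabCoef hcpTab z 0 • hcpBInt 0 + tabCoef hcpTab z 1 • hcpBInt 1 + tabCoef hcpTab z 2 • hcpBInt 2 ∧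
      |tabCoef hcpTab z 0| + |tabCoef hcpTab z 1| + |tabCoef hcpTab z 2| ≤ 9 := by
  decide

/-- Second moment of the fcc integer model: `Σ (z·x)² = 16‖x‖²`. [this file] -/
theorem fccList_moment (x : E3) :
    (fccList.map fun z : Fin 3 → ℤ => ((z 0 : ℝ) * x 0 + (z 1 : ℝ) * x 1 + (z 2 : ℝ) * x 2) ^ 2).sum =
      16 * (x 0 ^ 2 + x 1 ^ 2 + x 2 ^ 2) := by
  simp [fccList]
  ring

/-- Second moment of the hcp integer model: `Σ (z·x)² = 144‖x‖²`. [this file] -/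
theorem hcpList_moment (x : E3) :
    (hcpList.map fun z : Fin 3 → ℤ => ((z 0 : ℝ) * x 0 + (z 1 : ℝ) * x 1 + (z 2 : ℝ) * x 2) ^ 2).sum =
      144 * (x 0 ^ 2 + x 1 ^ 2 + x 2 ^ 2) := by
  simp [hcpList]
  ring

/-- ★ ISOTROPY of the fcc two-shell pattern. [this file] -/
theorem sum_inner_sq_fcc (x : E3) : ∑ v ∈ fccTwoShellPattern, ⟪v, x⟫_ℝ ^ 2 = 8 * ‖x‖ ^ 2 := by
  rw [fccTwoShellPattern, sum_inner_sq_scaledPattern fccInt_union_eq fccList_nodup two_ne_zero, fccList_moment, normSq_coords]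
  norm_num; ring

/-- ★ ISOTROPY of the hcp two-shell pattern. [this file] -/
theorem sum_inner_sq_hcp (x : E3) : ∑ v ∈ hcpTwoShellPattern, ⟪v, x⟫_ℝ ^ 2 = 8 * ‖x‖ ^ 2 := by
  rw [hcpTwoShellPattern, sum_inner_sq_scaledPattern hcpInt_union_eq hcpList_nodup (by norm_num), hcpList_moment,
    normSq_coords]
  norm_num; ring

/-- The scaled bases. -/
noncomputable def fccB (i : Fin 3) : E3 := (Real.sqrt (2 : ℕ))⁻¹ • intVec (fccBInt i)
/-- `hcpB` (docstring added by the landing lane; see the module docstring). [formal bookkeeping] -/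
noncomputable def hcpB (i : Fin 3) : E3 := (Real.sqrt (18 : ℕ))⁻¹ • intVec (hcpBInt i)

/-- `fccB_mem` (docstring added by the landing lane; see the module docstring). [formal bookkeeping] -/
theorem fccB_mem (i : Fin 3) : fccB i ∈ fccTwoShellPattern :=
  Finset.mem_image.2 ⟨fccBInt i, fccBInt_mem i, rfl⟩

/-- `hcpB_mem` (docstring added by the landing lane; see the module docstring). [formal bookkeeping] -/
theorem hcpB_mem (i : Fin 3) : hcpB i ∈ hcpTwoShellPattern :=
  Finset.mem_image.2 ⟨hcpBInt i, hcpBInt_mem i, rfl⟩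

/-- `linearIndependent_fccB` (docstring added by the landing lane; see the module docstring). [formal bookkeeping] -/
theorem linearIndependent_fccB : LinearIndependent ℝ fccB := by
  rw [Fintype.linearIndependent_iff]
  intro g hg i
  have h := fun j => congrArg (fun v : E3 => v j) hg
  have h0 := h 0
  have h1 := h 1
  have h2 := h 2
  simp [Fin.sum_univ_three, fccB, fccBInt, intVec_apply] at h0 h1 h2
  field_simp at h0 h1 h2
  fin_cases i <;> simp <;> linarith

/-- `linearIndependent_hcpB` (docstring added by the landing lane; see the module docstring). [formal bookkeeping] -/
theorem linearIndependent_hcpB : LinearIndependent ℝ hcpB := by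
  rw [Fintype.linearIndependent_iff]
  intro g hg i
  have h := fun j => congrArg (fun v : E3 => v j) hg
  have h0 := h 0
  have h1 := h 1
  have h2 := h 2
  simp [Fin.sum_univ_three, hcpB, hcpBInt, intVec_apply] at h0 h1 h2
  field_simp at h0 h1 h2
  fin_cases i <;> simp <;> linarith

/-- `fcc_coef` (docstring added by the landing lane; see the module docstring). [formal bookkeeping] -/
theorem fcc_coef : ∀ v ∈ fccTwoShellPattern, ∃ c : Fin 3 → ℤ, ((1 : ℕ) : ℝ) • v = ∑ i, (c i : ℝ) • fccB i ∧ ∑ i, |c i| ≤ ((3 : ℕ) : ℤ) := by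
  intro v hv
  obtain ⟨z, hz, rfl⟩ := Finset.mem_image.1 hv
  obtain ⟨h1, h2⟩ := fccTab_spec z hz
  refine ⟨tabCoef fccTab z, scaled_eq_sum_of_int (by simpa using h1), ?_⟩
  rw [Fin.sum_univ_three]; exact_mod_cast h2

/-- `hcp_coef` (docstring added by the landing lane; see the module docstring). [formal bookkeeping] -/
theorem hcp_coef : ∀ v ∈ hcpTwoShellPattern, ∃ c : Fin 3 → ℤ, ((2 : ℕ) : ℝ) • v = ∑ i, (c i : ℝ) • hcpB i ∧ ∑ i, |c i| ≤ ((9 : ℕ) : ℤ) := by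
  intro v hv
  obtain ⟨z, hz, rfl⟩ := Finset.mem_image.1 hv
  obtain ⟨h1, h2⟩ := hcpTab_spec z hz
  refine ⟨tabCoef hcpTab z, scaled_eq_sum_of_int (by simpa using h1), ?_⟩
  rw [Fin.sum_univ_three]; exact_mod_cast h2

end PatternRigidProof

/-! ## §R6 The theorem -/

open PatternRigidProof in
/-- ★★ **`PatternRigid (2/5) (1/100)`** — the [FINITE] leaf (iv) of the Z2 record, proved WITHOUT enumeration: an injective relabelling of either
two-shell model pattern into the two Barlow shells which, read through a linear map within `2/5` of an isometry, is `1/100`-close to a linear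
frame, is the restriction of a linear isometry of `E3`. [this file] -/
theorem patternRigid_two_fifths : PatternRigid (2 / 5) (1 / 100) := by
  intro s hs X A₀ hXQ P φ hP hφ hinj
  have hX : ∀ u : E3, 3 / 5 * ‖u‖ ≤ ‖X u‖ := fun u => by
    have := norm_map_ge_of_near_isometry hXQ u; linarith
  obtain ⟨hop, hom⟩ := labels_sign hs
  have hπT : ∀ v ∈ P, φ v ∈ (twoShellIdx (s 0) (-s (-1))).image (idxPos s) := fun v hv => by
    obtain ⟨t, ht, h⟩ := (mem_twoShellRef_iff hs).1 (hφ v hv).1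
    exact Finset.mem_image.2 ⟨t, ht, h.symm⟩
  have hπA : ∀ v ∈ P, ‖X (φ v) - A₀ v‖ ≤ 1 / 100 := fun v hv => (hφ v hv).2
  have hI : (twoShellIdx (s 0) (-s (-1))).card ≤ 18 := (card_twoShellIdx hop hom).le
  have hT : ∀ t ∈ twoShellIdx (s 0) (-s (-1)), IsBarlowInt (idxPos s t) := fun t _ => isBarlowInt_idxPos s t
  rcases hP with rfl | rfl
  · exact rigid_core fccTwoShellPattern _ (idxPos s) (by rw [card_fccTwoShellPattern]; exact hI) fccB linearIndependent_fccB
      fccB_mem 1 one_ne_zero 3 fcc_coef hT sum_inner_sq_fcc (sum_inner_idxPos_sq hs) hX (by norm_num) hπT hπA hinj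
  · exact rigid_core hcpTwoShellPattern _ (idxPos s) (by rw [card_hcpTwoShellPattern]; exact hI) hcpB linearIndependent_hcpB
      hcpB_mem 2 two_ne_zero 9 hcp_coef hT sum_inner_sq_hcp (sum_inner_idxPos_sq hs) hX (by norm_num) hπT hπA hinj

/-- `PatternRigid` is antitone in the tolerance. [this file] -/
theorem PatternRigid.of_le {m τ₀ τ : ℝ} (h : PatternRigid m τ₀) (hτ : τ ≤ τ₀) : PatternRigid m τ :=
  fun s hs X A₀ hXQ P φ hP hφ hinj => h s hs X A₀ hXQ P φ hP (fun v hv => ⟨(hφ v hv).1, (hφ v hv).2.trans hτ⟩) hinj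

/-- ★★ Hence `PatternRigid (2/5) τ` for every `τ ≤ 1/100` — in particular for the record's `τ < 1/2000`. [this file] -/
theorem patternRigid_of_le {τ : ℝ} (hτ : τ ≤ 1 / 100) : PatternRigid (2 / 5) τ := patternRigid_two_fifths.of_le hτ

/-- ★★★ THE Z2 RECORD WITHOUT THE RIGIDITY HYPOTHESIS: `FarCoreExcess (1/25) (1/2000) (1/(2·10⁷))` follows from `HcpEnergyUpper u` with
`u ≤ −(1/(2·10⁷) + 10⁻⁹)` and the certified far-window table at tolerance `1/2000 − τ` (`0 < τ ≤ 1/100`). [this file] -/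
theorem farCoreExcess_record_of_farWindowData' {u τ : ℝ} (hτ : 0 < τ) (hτ' : τ ≤ 1 / 100) (hU : HcpEnergyUpper u)
    (hu : u + 1 / (2 * 10 ^ 7) + 1 / 10 ^ 9 ≤ 0)
    (hcert : ∀ (w : Fin 6 → ℤ) (X : E3 →ₗ[ℝ] E3), FarWindowData (1 / 25) (1 / 2000 - τ) w X →
      windowSixUp w X ^ 2 ≤ 24 * (-(u + 1 / (2 * 10 ^ 7) + 1 / 10 ^ 9)) * windowTwelveLo w X) :
    FarCoreExcess (1 / 25) (1 / 2000) (1 / (2 * 10 ^ 7)) :=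
  farCoreExcess_record_of_farWindowData hτ hU hu (patternRigid_of_le hτ') hcert

end Summit.AtomisticToContinuum.Crystallization.Theorems.OverbindingBudgetAffineFarSmoothSplit
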